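/-
Copyright (c) 2026. All rights reserved.
Released under Apache 2.0 license as described in the file LICENSE.
Authors: abc-iut cell, seat abc-iut-w6-d025 (gen 2; block C / W6, row «Cor36-LOGOBS-TELE»).
-/
import Literature.AnabelianGeometry.AbsoluteAnabelian.AbsTopIII.FrobeniusPictureMLFTelecoreConstruction

/-!
# [AbsTopIII] Cor. 3.6 (iii), second clause, telecore half: the boundary set of the glued family
# on the telecore diagram `𝒟_An` (canonical split at the last visit to `Anab`)

S. Mochizuki, *Topics in Absolute Anabelian Geometry III*, Cor. 3.6 (iii) p. 80 of the kurims
manuscript (`paper:url-5493eb38cbb7`; bib key `MochizukiAbsTopIII2015`): the family of homotopies of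
`𝔖_log` "is compatible with the families of homotopies that constitute the core and telecore
structures of (i), (ii)" — telecore half typed by seat abc-iut-L4-t5 as
`LogFrobeniusData.LogObsCompatTelecoreStmt τ`: ONE family of homotopies on the telecore diagram
`𝒟_An` containing the telecore family `𝒥` (pairs `([γ₃]∘[γ₁], [γ₃]∘[γ₂])` through `Anab`) and, along
`𝒟_{≤3} ↪ 𝒟_An`, the `𝔖_log` family (Def. 3.5 (ii): compatible = contained in one family).

This file is the COMBINATORIAL half of that family (row «Cor36-LOGOBS-TELE»; §0 of the paper:
saturated sets of co-verticial pairs).  Unlike on `𝒟` (seat abc-iut-w5-d053's `GlueE`, a plain union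
of the core pairs and the `𝔖_log` pairs), on `𝒟_An` the telecore edges `φ_⋏ : Anab → ⋏` RE-ENTER the
first two rows, so that saturation forces mixed pairs such as `([γ₁]∘[φ_□]∘[λ^×], [γ₂]∘[φ_□]∘[λ^{×pf}])`.
The remedy is the CANONICAL SPLIT of a path of `𝒟_An` at its last visit to the core vertex `Anab`:
every path is either telecore-free — a path of the sub-graph `Γ⃗_𝒮 ⊆ Γ⃗_{𝒟_An}` of the observable
`(𝒟_{≤5}, Anab)` (typed on the vertex set `FVtx` of `𝒟_An` with the telecore-free edges `FHom`, included
by `jS`) — or splits uniquely as `[γ] · φ_⋏ · jS u` with `[γ]` ending at `Anab` and `u` a telecore-free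
tail (`tele_cases`, `tele_decomp_unique`, `jS_mapPath_injective`, `jS_mapPath_ne_tele`).  Given a set
`E₀` of pairs of telecore-free paths (the boundary set of the family realising the cores and `𝔖_log`),
the glued boundary set `TGlueE E₀` consists of: the images of `E₀`-pairs between vertices of `𝒟_{≤4}`;
ALL co-verticial pairs into `Anab` (the core/telecore pairs); and the pairs `([γ₁]·φ_⋏·u, [γ₂]·φ_⋏·v)`
with `[γ₁], [γ₂]` co-verticial into `Anab`, the SAME telecore edge, and tails `u = v` or
`(u, v) ∈ E₀`.  **It is saturated whenever `E₀` is** (`isSaturated_tGlueE`): transitivity holds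
because the split of the middle path is unique; pre- and post-composition by the case analysis
`tele_cases` of the added segment.  The homotopies and the theorem are in the continuation file.
Pure combinatorics of oriented graphs; nothing here takes a side on inter-universal Teichmüller
theory or bears on [IUTchIII] Cor. 3.12.
-/

namespace Literature.AnabelianGeometry.AbsoluteAnabelian

open _root_.CategoryTheory _root_.Quiver

universe u

namespace LogFrobeniusData

open DiagramOfCategories

/-! ### The telecore-free sub-graph `Γ⃗_𝒮` of `Γ⃗_{𝒟_An}` -/

/-- The vertices of `𝒟_An`, as vertices of the telecore-free sub-graph `Γ⃗_𝒮` (`𝒮 = (𝒟_{≤5}, Anab)`,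
Def. 3.5 (iv) (a): `𝒯 ⊇ 𝒮` with the same vertices). [cite: MochizukiAbsTopIII2015, Definition 3.5 (iv) p.76] -/
structure FVtx : Type where
  /-- the underlying vertex of `𝒟_An` -/
  v : (teleShape anJ.{u}).Vertex

/-- The telecore-free edges of `𝒟_An`: the edges of `𝒟_{≤4}` and the observation edge `κ_An` (no edge
leaves `Anab`). [cite: MochizukiAbsTopIII2015, Definition 3.5 (iv) p.76] -/
def FHom : FVtx.{u} → FVtx.{u} → Type u
  | ⟨ExtVertex.base a⟩, ⟨ExtVertex.base b⟩ => (a ⟶ b)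
  | ⟨ExtVertex.base a⟩, ⟨ExtVertex.obs⟩ => coreI5.{u} a
  | ⟨ExtVertex.obs⟩, ⟨ExtVertex.base _⟩ => PEmpty.{u + 1}
  | ⟨ExtVertex.obs⟩, ⟨ExtVertex.obs⟩ => PEmpty.{u + 1}

/-- `Γ⃗_𝒮` as a quiver. [cite: MochizukiAbsTopIII2015, Definition 3.5 (iv) p.76] -/
instance fQuiver : Quiver.{u} FVtx.{u} := ⟨FHom⟩

/-- The inclusion `Γ⃗_𝒮 ↪ Γ⃗_{𝒟_An}` on edges. [cite: MochizukiAbsTopIII2015, Definition 3.5 (iv) p.76] -/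
def jHom : ∀ {x y : FVtx.{u}}, (x ⟶ y) → (x.v ⟶ y.v)
  | ⟨ExtVertex.base _⟩, ⟨ExtVertex.base _⟩, e => e
  | ⟨ExtVertex.base _⟩, ⟨ExtVertex.obs⟩, i => i
  | ⟨ExtVertex.obs⟩, ⟨ExtVertex.base _⟩, e => PEmpty.elim e
  | ⟨ExtVertex.obs⟩, ⟨ExtVertex.obs⟩, e => PEmpty.elim e

/-- **The inclusion `Γ⃗_𝒮 ↪ Γ⃗_{𝒟_An}`** as a morphism of oriented graphs (the identity on vertices).
[cite: MochizukiAbsTopIII2015, Definition 3.5 (iv) p.76] -/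
@[reducible] def jS : FVtx.{u} ⥤q (teleShape anJ.{u}).Vertex where
  obj x := x.v
  map e := jHom e

/-- The telecore edge `φ_⋏ : Anab → ⋏` as an edge of `Γ⃗_{𝒟_An}` (seat abc-iut-L4-t5's `ePhi`, re-typed on
the nose over `(teleShape anJ).obs`). [cite: MochizukiAbsTopIII2015, Corollary 3.6 (ii) p.79] -/
abbrev phiEdge {γ : SubVertex {a : LFVertex | a.row ≤ 4}} (j : anJ.{u} γ) :
    (teleShape anJ.{u}).obs ⟶ (teleShape anJ.{u}).base γ := j

/-- A telecore-free edge of `𝒟_An` out of a vertex of `𝒟_{≤4}` is an edge of `Γ⃗_𝒮`.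
[cite: MochizukiAbsTopIII2015, Definition 3.5 (iv) p.76] -/
def ofTHom {ξ : SubVertex {a : LFVertex | a.row ≤ 4}} :
    ∀ {d : (teleShape anJ.{u}).Vertex}, ((teleShape anJ.{u}).base ξ ⟶ d) →
      ((⟨(teleShape anJ.{u}).base ξ⟩ : FVtx.{u}) ⟶ ⟨d⟩)
  | ExtVertex.base _, e => e
  | ExtVertex.obs, i => i

/-- `jS ∘ ofTHom = id` on edges. [folklore] -/
private theorem jHom_ofTHom {ξ : SubVertex {a : LFVertex | a.row ≤ 4}} :
    ∀ {d : (teleShape anJ.{u}).Vertex} (e : (teleShape anJ.{u}).base ξ ⟶ d), jHom (ofTHom e) = e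
  | ExtVertex.base _, _ => rfl
  | ExtVertex.obs, _ => rfl

/-- There is no telecore-free edge out of `Anab`. [cite: MochizukiAbsTopIII2015, Definition 3.5 (iii) p.75] -/
theorem fHom_obs_false {y : FVtx.{u}} (e : (⟨(teleShape anJ.{u}).obs⟩ : FVtx.{u}) ⟶ y) : False := by
  obtain ⟨v⟩ := y
  cases v with
  | base _ => exact PEmpty.elim e
  | obs => exact PEmpty.elim e

/-- A telecore-free path starting at `Anab` ends at `Anab` (it is empty). [cite: MochizukiAbsTopIII2015, Definition 3.5 (iii) p.75] -/
theorem eq_obs_of_fPath_obs : ∀ {y : FVtx.{u}} (_ : Path (⟨(teleShape anJ.{u}).obs⟩ : FVtx.{u}) y),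
    y = ⟨(teleShape anJ.{u}).obs⟩ := by
  intro y r
  induction r with
  | nil => rfl
  | cons r e ih =>
    cases ih
    exact (fHom_obs_false e).elim

/-- `jHom` is injective (heterogeneously, over equal sources). [folklore] -/
private theorem jHom_heq_inj {x x' y : FVtx.{u}} (hx : x = x') {e : x ⟶ y} {e' : x' ⟶ y}
    (h : HEq (jHom e) (jHom e')) : HEq e e' := by
  subst hx
  obtain ⟨vx⟩ := x
  obtain ⟨vy⟩ := y
  cases vx with
  | obs => exact (fHom_obs_false e).elim
  | base _ =>
    cases vy with
    | base _ => exact h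
    | obs => exact h

/-- **The inclusion `Γ⃗_𝒮 ↪ Γ⃗_{𝒟_An}` is injective on paths** (Def. 3.5 (iv) (a): `𝒯 ⊇ 𝒮`).
[cite: MochizukiAbsTopIII2015, Definition 3.5 (iv) p.76] -/
theorem jS_mapPath_injective {x y : FVtx.{u}} :
    ∀ (u v : Path x y), jS.mapPath u = jS.mapPath v → u = v := by
  intro u
  induction u with
  | nil =>
    intro v h
    cases v with
    | nil => rfl
    | cons v e => exact absurd h (Path.nil_ne_cons _ _)
  | cons u e ih =>
    intro v h
    cases v with
    | nil => exact absurd h (Path.cons_ne_nil _ _)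
    | cons v e' =>
      rename_i y₁ _ y₂
      have hy : y₁ = y₂ := by
        obtain ⟨_⟩ := y₁; obtain ⟨_⟩ := y₂
        exact congrArg FVtx.mk (Path.obj_eq_of_cons_eq_cons h)
      subst hy
      obtain rfl := ih v (eq_of_heq (Path.heq_of_cons_eq_cons h))
      obtain rfl : e = e' := eq_of_heq (jHom_heq_inj rfl (Path.hom_heq_of_cons_eq_cons h))
      rfl

/-! ### The canonical split of a path of `𝒟_An` at its last visit to `Anab` -/

/-- **Every path of `𝒟_An` is telecore-free or splits at its last telecore edge**: either it is the
image of a path of `Γ⃗_𝒮`, or it is `[γ] · φ_⋏ · jS w` with `[γ]` ending at `Anab` and `w` a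
telecore-free tail. [cite: MochizukiAbsTopIII2015, Definition 3.5 (iv) p.76] -/
theorem tele_cases {c : (teleShape anJ.{u}).Vertex} :
    ∀ {d : (teleShape anJ.{u}).Vertex} (r : Path c d),
      (∃ r' : Path (⟨c⟩ : FVtx.{u}) ⟨d⟩, r = jS.mapPath r') ∨
        ∃ (γ : SubVertex {a : LFVertex | a.row ≤ 4}) (r₁ : Path c (teleShape anJ.{u}).obs)
          (j : anJ.{u} γ) (w : Path (⟨(teleShape anJ.{u}).base γ⟩ : FVtx.{u}) ⟨d⟩),
          r = (r₁.cons (phiEdge j)).comp (jS.mapPath w) := by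
  intro d r
  induction r with
  | nil => exact Or.inl ⟨Path.nil, rfl⟩
  | cons r e ih =>
    rename_i x d
    rcases ih with ⟨r', rfl⟩ | ⟨γ, r₁, j, w, rfl⟩
    · cases x with
      | obs =>
        -- the last edge is a telecore edge
        cases d with
        | obs => exact PEmpty.elim e
        | base γ => exact Or.inr ⟨γ, jS.mapPath r', e, Path.nil, rfl⟩
      | base ξ =>
        cases d with
        | obs => exact Or.inl ⟨r'.cons (ofTHom e), rfl⟩
        | base δ => exact Or.inl ⟨r'.cons (ofTHom e), rfl⟩
    · cases x with
      | obs =>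
        cases d with
        | obs => exact PEmpty.elim e
        | base γ' => exact Or.inr ⟨γ', (r₁.cons (phiEdge j)).comp (jS.mapPath w), e, Path.nil, rfl⟩
      | base ξ =>
        cases d with
        | obs => exact Or.inr ⟨γ, r₁, j, w.cons (ofTHom e), rfl⟩
        | base δ => exact Or.inr ⟨γ, r₁, j, w.cons (ofTHom e), rfl⟩

/-- A telecore-free path out of a vertex of `𝒟_{≤4}` is not of the split form (it does not visit
`Anab`: telecore edges are the only edges out of the core vertex, Def. 3.5 (iv) (a)).
[cite: MochizukiAbsTopIII2015, Definition 3.5 (iv) p.76] -/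
theorem jS_mapPath_ne_tele {α γ : SubVertex {a : LFVertex | a.row ≤ 4}} {y : FVtx.{u}}
    (q : Path ((teleShape anJ.{u}).base α) (teleShape anJ.{u}).obs) (j : anJ.{u} γ) :
    ∀ (w : Path (⟨(teleShape anJ.{u}).base γ⟩ : FVtx.{u}) y)
      (u : Path (⟨(teleShape anJ.{u}).base α⟩ : FVtx.{u}) y),
      jS.mapPath u ≠ (q.cons (phiEdge j)).comp (jS.mapPath w) := by
  intro w
  induction w with
  | nil =>
    intro u h
    cases u with
    | nil => exact absurd h.symm (Path.cons_ne_nil _ _)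
    | cons u e =>
      rename_i y'
      erw [Prefunctor.mapPath_cons, Prefunctor.mapPath_nil, Path.comp_nil] at h
      have hy : y' = ⟨(teleShape anJ.{u}).obs⟩ := by
        obtain ⟨_⟩ := y'
        exact congrArg FVtx.mk (Path.obj_eq_of_cons_eq_cons h)
      subst hy
      exact (fHom_obs_false e).elim
  | cons w e' ih =>
    intro u h
    cases u with
    | nil => exact absurd h (Path.nil_ne_cons _ _)
    | cons u e =>
      rename_i y₁ _ y₂
      erw [Prefunctor.mapPath_cons, Prefunctor.mapPath_cons, Path.comp_cons] at h
      have hy : y₂ = y₁ := by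
        obtain ⟨_⟩ := y₁; obtain ⟨_⟩ := y₂
        exact congrArg FVtx.mk (Path.obj_eq_of_cons_eq_cons h)
      subst hy
      exact ih u (eq_of_heq (Path.heq_of_cons_eq_cons h))

/-- **Uniqueness of the split at the last telecore edge** (telecore edges leave the core vertex only,
Def. 3.5 (iv) (a)). [cite: MochizukiAbsTopIII2015, Definition 3.5 (iv) p.76] -/
theorem tele_decomp_unique {c : (teleShape anJ.{u}).Vertex}
    {γ γ' : SubVertex {a : LFVertex | a.row ≤ 4}} {y : FVtx.{u}}
    (p : Path c (teleShape anJ.{u}).obs) (p' : Path c (teleShape anJ.{u}).obs) (j : anJ.{u} γ)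
    (j' : anJ.{u} γ') :
    ∀ (u' : Path (⟨(teleShape anJ.{u}).base γ'⟩ : FVtx.{u}) y)
      (u : Path (⟨(teleShape anJ.{u}).base γ⟩ : FVtx.{u}) y),
      (p.cons (phiEdge j)).comp (jS.mapPath u) = (p'.cons (phiEdge j')).comp (jS.mapPath u') →
        γ = γ' ∧ p = p' ∧ HEq j j' ∧ HEq u u' := by
  intro u'
  induction u' with
  | nil =>
    intro u h
    cases u with
    | nil =>
      erw [Prefunctor.mapPath_nil, Path.comp_nil, Path.comp_nil] at h
      have hγ := Path.obj_eq_of_cons_eq_cons h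
      cases hγ
      exact ⟨rfl, eq_of_heq (Path.heq_of_cons_eq_cons h), Path.hom_heq_of_cons_eq_cons h, HEq.rfl⟩
    | cons u e =>
      rename_i y'
      erw [Prefunctor.mapPath_cons, Prefunctor.mapPath_nil, Path.comp_nil, Path.comp_cons] at h
      have hy : y' = ⟨(teleShape anJ.{u}).obs⟩ := by
        obtain ⟨_⟩ := y'
        exact congrArg FVtx.mk (Path.obj_eq_of_cons_eq_cons h)
      subst hy
      exact (fHom_obs_false e).elim
  | cons u' e' ih =>
    intro u h
    cases u with
    | nil =>
      rename_i y'
      erw [Prefunctor.mapPath_nil, Prefunctor.mapPath_cons, Path.comp_nil, Path.comp_cons] at h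
      have hy : y' = ⟨(teleShape anJ.{u}).obs⟩ := by
        obtain ⟨_⟩ := y'
        exact congrArg FVtx.mk (Path.obj_eq_of_cons_eq_cons h).symm
      subst hy
      exact (fHom_obs_false e').elim
    | cons u e =>
      rename_i y₁ _ y₂
      erw [Prefunctor.mapPath_cons, Prefunctor.mapPath_cons, Path.comp_cons, Path.comp_cons] at h
      have hy : y₂ = y₁ := by
        obtain ⟨_⟩ := y₁; obtain ⟨_⟩ := y₂
        exact congrArg FVtx.mk (Path.obj_eq_of_cons_eq_cons h)
      subst hy
      obtain ⟨hγ, hp, hj, hu⟩ := ih u (eq_of_heq (Path.heq_of_cons_eq_cons h))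
      cases hγ
      cases hu
      obtain rfl : e = e' := eq_of_heq (jHom_heq_inj rfl (Path.hom_heq_of_cons_eq_cons h))
      exact ⟨rfl, hp, hj, HEq.rfl⟩

/-! ### The glued boundary set -/

section Boundary

variable (E₀ : ∀ ⦃x y : FVtx.{u}⦄, Path x y → Path x y → Prop)

/-- **The glued boundary set on `𝒟_An`** determined by a set `E₀` of pairs of telecore-free paths:
(`free`) the images of `E₀`-pairs between vertices of `𝒟_{≤4}`; (`obs`) ALL co-verticial pairs into
the core vertex `Anab` (Def. 3.5 (iii): core); (`tele`) the pairs `([γ₁]·φ_⋏·u, [γ₂]·φ_⋏·v)` with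
`[γ₁], [γ₂]` co-verticial into `Anab`, one telecore edge `φ_⋏`, and telecore-free tails into `𝒟_{≤4}`
that are equal or `E₀`-related (Def. 3.5 (iv) (b) pairs, continued past the telecore edge).
[cite: MochizukiAbsTopIII2015, Corollary 3.6 (iii) p.80] -/
inductive TGlueE : ∀ ⦃a b : (teleShape anJ.{u}).Vertex⦄, Path a b → Path a b → Prop
  | free {α β : SubVertex {a : LFVertex | a.row ≤ 4}}
      {u v : Path (⟨(teleShape anJ.{u}).base α⟩ : FVtx.{u}) ⟨(teleShape anJ.{u}).base β⟩} :
      E₀ u v → TGlueE (jS.mapPath u) (jS.mapPath v)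
  | obs {a : (teleShape anJ.{u}).Vertex} (p q : Path a (teleShape anJ.{u}).obs) : TGlueE p q
  | tele {a : (teleShape anJ.{u}).Vertex} {γ β : SubVertex {a : LFVertex | a.row ≤ 4}}
      (p q : Path a (teleShape anJ.{u}).obs) (j : anJ.{u} γ)
      {u v : Path (⟨(teleShape anJ.{u}).base γ⟩ : FVtx.{u}) ⟨(teleShape anJ.{u}).base β⟩} :
      (u = v ∨ E₀ u v) →
        TGlueE ((p.cons (phiEdge j)).comp (jS.mapPath u)) ((q.cons (phiEdge j)).comp (jS.mapPath v))

variable {E₀}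

/-- Post-composition of a pair whose components pass through `Anab` after the prefixes `P`, `Q`:
`(P·r, Q·r)` is glued for every `r` out of `Anab` (bookkeeping common to the three constructors).
[cite: MochizukiAbsTopIII2015, Section 0 p.26] -/
theorem tGlueE_postcomp_obs {a d : (teleShape anJ.{u}).Vertex}
    (P Q : Path a (teleShape anJ.{u}).obs) (r : Path (teleShape anJ.{u}).obs d) :
    TGlueE E₀ (P.comp r) (Q.comp r) := by
  rcases tele_cases r with ⟨r', rfl⟩ | ⟨γ, r₁, j, w, rfl⟩
  · have hd := eq_obs_of_fPath_obs r'
    cases hd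
    cases r' with
    | nil => exact TGlueE.obs P Q
    | cons r' e =>
      have hy := eq_obs_of_fPath_obs r'
      cases hy
      exact (fHom_obs_false e).elim
  · cases d with
    | obs => exact TGlueE.obs _ _
    | base β =>
      erw [← Path.comp_assoc, ← Path.comp_assoc, Path.comp_cons, Path.comp_cons]
      exact TGlueE.tele (P.comp r₁) (Q.comp r₁) j (Or.inl rfl)

variable (hE₀ : IsSaturated E₀)
include hE₀

/-- The relation "equal or `E₀`-related" on tails is transitive. [folklore] -/
private theorem tailRel_trans {x y : FVtx.{u}} {u v w : Path x y}
    (h₁ : u = v ∨ E₀ u v) (h₂ : v = w ∨ E₀ v w) : u = w ∨ E₀ u w := by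
  rcases h₁ with rfl | h₁
  · exact h₂
  · rcases h₂ with rfl | h₂
    · exact Or.inr h₁
    · exact Or.inr (hE₀.trans h₁ h₂)

/-- … and post-composable. [folklore] -/
private theorem tailRel_postcomp {x y z : FVtx.{u}} {u v : Path x y} (r : Path y z)
    (h : u = v ∨ E₀ u v) : u.comp r = v.comp r ∨ E₀ (u.comp r) (v.comp r) := by
  rcases h with rfl | h
  · exact Or.inl rfl
  · exact Or.inr (hE₀.postcomp h r)

/-- **The glued boundary set is saturated** (§0 (a)–(e): partial diagonal, transitivity — by the
uniqueness of the canonical split of the middle path —, pre- and post-composition — by the case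
analysis `tele_cases` of the added segment). [cite: MochizukiAbsTopIII2015, Section 0 p.26] -/
theorem isSaturated_tGlueE : IsSaturated (TGlueE.{u} E₀) where
  refl_left := by
    intro a b P Q h
    cases h with
    | free h => exact TGlueE.free (hE₀.refl_left h)
    | obs p q => exact TGlueE.obs p p
    | tele p q j h => exact TGlueE.tele p p j (Or.inl rfl)
  refl_right := by
    intro a b P Q h
    cases h with
    | free h => exact TGlueE.free (hE₀.refl_right h)
    | obs p q => exact TGlueE.obs q q
    | tele p q j h => exact TGlueE.tele q q j (Or.inl rfl)
  trans := by
    intro a b P Q R h₁ h₂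
    cases h₁ with
    | obs p q => exact TGlueE.obs p R
    | free h₁ =>
      rename_i α β u v
      generalize hQ : jS.mapPath v = Q at h₂
      cases h₂ with
      | free h₂ =>
        rename_i v' w
        obtain rfl := jS_mapPath_injective _ _ hQ
        exact TGlueE.free (hE₀.trans h₁ h₂)
      | tele p' q' j' h₂ => exact absurd hQ (jS_mapPath_ne_tele _ _ _ _)
    | tele p q j huv =>
      rename_i γ β u v
      generalize hQ : (q.cons (phiEdge j)).comp (jS.mapPath v) = Q at h₂
      cases h₂ with
      | free h₂ => exact absurd hQ.symm (jS_mapPath_ne_tele _ _ _ _)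
      | tele p' q' j' h₂ =>
        rename_i γ' v' w
        obtain ⟨hγ, rfl, hj, hv⟩ := tele_decomp_unique _ _ _ _ _ _ hQ
        cases hγ
        cases hj
        cases hv
        exact TGlueE.tele p q' j (tailRel_trans hE₀ huv h₂)
  precomp := by
    intro a b c P Q h r
    cases h with
    | obs p q => exact TGlueE.obs _ _
    | free h =>
      rename_i α β u v
      rcases tele_cases r with ⟨r', rfl⟩ | ⟨γ, r₁, j, w, rfl⟩
      · cases c with
        | obs => exact absurd (eq_obs_of_fPath_obs r') (by intro h'; cases h')
        | base ξ =>
          erw [← Prefunctor.mapPath_comp, ← Prefunctor.mapPath_comp]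
          exact TGlueE.free (hE₀.precomp h r')
      · erw [Path.comp_assoc, Path.comp_assoc, ← Prefunctor.mapPath_comp, ← Prefunctor.mapPath_comp]
        exact TGlueE.tele r₁ r₁ j (Or.inr (hE₀.precomp h w))
    | tele p q j huv =>
      erw [← Path.comp_assoc, ← Path.comp_assoc, Path.comp_cons, Path.comp_cons]
      exact TGlueE.tele (r.comp p) (r.comp q) j huv
  postcomp := by
    intro a b d P Q h r
    cases h with
    | obs p q => exact tGlueE_postcomp_obs p q r
    | free h =>
      rename_i α β u v
      rcases tele_cases r with ⟨r', rfl⟩ | ⟨γ, r₁, j, w, rfl⟩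
      · cases d with
        | obs => exact TGlueE.obs _ _
        | base δ =>
          erw [← Prefunctor.mapPath_comp, ← Prefunctor.mapPath_comp]
          exact TGlueE.free (hE₀.postcomp h r')
      · -- the added segment visits `Anab`: the new pair splits at the last telecore edge of `r`
        cases d with
        | obs => exact TGlueE.obs _ _
        | base δ =>
          erw [← Path.comp_assoc, ← Path.comp_assoc, Path.comp_cons, Path.comp_cons]
          exact TGlueE.tele _ _ j (Or.inl rfl)
    | tele p q j huv =>
      rename_i γ β u v
      rcases tele_cases r with ⟨r', rfl⟩ | ⟨γ', r₁, j', w, rfl⟩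
      · cases d with
        | obs => exact TGlueE.obs _ _
        | base δ =>
          erw [Path.comp_assoc, Path.comp_assoc, ← Prefunctor.mapPath_comp, ← Prefunctor.mapPath_comp]
          exact TGlueE.tele p q j (tailRel_postcomp hE₀ r' huv)
      · cases d with
        | obs => exact TGlueE.obs _ _
        | base δ =>
          erw [← Path.comp_assoc, ← Path.comp_assoc, Path.comp_cons, Path.comp_cons]
          exact TGlueE.tele _ _ j' (Or.inl rfl)

end Boundary

end LogFrobeniusData

end Literature.AnabelianGeometry.AbsoluteAnabelian
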